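import Literature.NumberTheory.EllipticCurves.CongruentNumberEvenMonskySelmerKernel
import Literature.NumberTheory.EllipticCurves.SelmerFiniteProofs
import HarnessLib

/-!
# Monsky's `2`-Selmer formula for `E_n : y² = x³ − n²x`, `n = 2p₁⋯p_k`: EQUALITY `#Sel⁽²⁾(E_n/ℚ) = 2^{2+s(n)}`

P. Monsky, appendix to D. R. Heath-Brown, *The size of Selmer groups for the congruent number problem, II*,
Invent. Math. 118 (1994), even case (typescript p. 41, printed as "a sketch proof"): for `n = 2p₁⋯p_k` with
distinct odd primes `pᵢ`, "`2^{s(D)}` is the size of the kernel of the matrix `M = ( Aᵀ + D₂  D₋₁ ; D₂  A + D₂ )`",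
`#S⁽²⁾ = 2^{2+s(D)}` (Heath-Brown §1). The tree vendored this as the NAMED FACT
`HeathBrown1994.monsky_card_selmerGroup_two_even`; `CongruentNumberEvenMonskySelmerBound.lean` proved the `≤` half.
THIS FILE PROVES THE `≥` HALF AND DISCHARGES THE FACT:

* `card_selmerGroup_two_ge_pow` — `2^{2+s(n)} ≤ #Sel⁽²⁾(E_n/ℚ)`: the normalising character
  `ν = (v₂(b), χ₄(b)) : Sel⁽²⁾ → (ℤ/2)²` is SURJECTIVE (the classes of the three torsion pairs `(2n², −n)`,
  `(n, −n²)`, `(2n, n)` — the Kummer images of `T₁, T₂, T₃`, `TwoDescentLocalSelmerOfExhibit.lean` — take the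
  values `(1, 1+χ₄(n)), (0, 1), (1, χ₄(n))`), so `[Sel⁽²⁾ : ker ν] = 4`; and `x ↦ c(∏pᵢ^{αᵢ}, candB β)`
  (`CongruentNumberEvenMonskySelmerKernel.lean`: a Selmer class for every `x = (β; α) ∈ ker M`, normalised, with
  coordinates `x`) is an INJECTION `ker M ↪ ker ν`; hence `#Sel⁽²⁾ = 4·#ker ν ≥ 4·#ker M = 2^{2+s}`
  (`Sel⁽²⁾` is finite: Silverman X.4.2(b), tree `finite_selmerGroup_holds`);
* `card_selmerGroup_two_eq_pow` — with the `≤` half: **`#Sel⁽²⁾(E_n/ℚ) = 2^{2+s(n)}`**;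
* **`HeathBrown1994.monsky_card_selmerGroup_two_even_holds : monsky_card_selmerGroup_two_even`** — the named
  fact is now a theorem of the tree (`fact-discharged`); every consumer `(hMe : monsky_card_selmerGroup_two_even)`
  of the cell `bsd-monsky` and of the `bsd-p2` census lane can be fed this term.

The proof is a complete `2`-descent (Silverman AEC X.1.4 / X.4.9) on the tree's cohomological `Sel⁽²⁾`: the upper
bound by necessary local conditions on Selmer classes, the lower bound by local solubility of the candidate
pairs at every place (torsion points at the `pᵢ` and `∞`, Kummer-unramified classes at the good primes, the
`2`-adic point `(5, √(125−5n²))` or `O` at `2` — the `2`-adic conditions being consequences of `Mx = 0`, which is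
the appendix's "it suffices to consider `p`-adic solubility for the various primes `p ∣ D₀`"). No `decide` on
`n`; uniform in `k`; axioms standard. Cell `bsd-monsky` (prover-B).

## References

* [HeathBrown1994SelmerCongruentII] D. R. Heath-Brown, Invent. Math. 118 (1994) 331–370: §1 (typescript p. 1
  L14–L20, `#S⁽²⁾ = 2^{2+s(D)}`); Appendix (P. Monsky) pp. 38–42, even `D` p. 40 L40 – p. 41 L36.
* [SilvermanAEC2009] J. H. Silverman, *The Arithmetic of Elliptic Curves*, 2nd ed., Prop. X.1.4, Thm. X.4.2,
  Prop. X.4.9.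
-/

noncomputable section

open scoped Classical

open WeierstrassCurve WeierstrassCurve.Affine WeierstrassCurve.Affine.Point
open Literature.NumberTheory.GaloisRepresentations
open Literature.NumberTheory.EllipticCurves.KramerTwoDescent
open Literature.NumberTheory.EllipticCurves.TwoDescentLocal
open Literature.NumberTheory.EllipticCurves.HeathBrown1994
open Literature.NumberTheory.EllipticCurves.CongruentNumberEvenMonskySelmer
open Literature.NumberTheory.EllipticCurves.MonskySelmerCandidates
open Literature.NumberTheory.EllipticCurves.CongruentNumberEvenMonskySelmerKernel
open IsDedekindDomain NumberField Rat.HeightOneSpectrum Matrix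

namespace Literature.NumberTheory.EllipticCurves

namespace CongruentNumberEvenMonskySelmerExact

variable {k : ℕ} {p : Fin k → ℕ}

/-- The two values of a bit. [folklore] -/
private theorem zmod2_cases (x : ZMod 2) : x = 0 ∨ x = 1 := by revert x; decide

/-- `1 + 1 = 0` in `ℤ/2`. [folklore] -/
private theorem one_add_one_zmod2 : (1 : ZMod 2) + 1 = 0 := by decide

/-- `2 ∏ pᵢ ≠ 0`. [folklore] -/
private theorem n_ne_zero (hp : ∀ i, (p i).Prime) : 2 * ∏ i, p i ≠ 0 :=
  mul_ne_zero two_ne_zero (Finset.prod_ne_zero_iff.mpr fun i _ => (hp i).ne_zero)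

/-- `v₂(2 ∏ pᵢ) = 1` for odd primes `pᵢ`. [folklore] -/
private theorem padicValRat_two_n (hp : ∀ i, (p i).Prime) (hp2 : ∀ i, p i ≠ 2) (hinj : Function.Injective p) :
    padicValRat 2 ((2 * ∏ i, p i : ℕ) : ℚ) = 1 := by
  haveI : Fact (Nat.Prime 2) := ⟨Nat.prime_two⟩
  have hprod : (∏ j, (p j : ℚ)) = (bitProd p (fun _ => 1) : ℚ) := by rw [cast_bitProd]; simp
  rw [show ((2 * ∏ j, p j : ℕ) : ℚ) = 2 * ∏ j, (p j : ℚ) by push_cast; ring,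
    padicValRat.mul two_ne_zero (Finset.prod_ne_zero_iff.mpr fun j _ => Nat.cast_ne_zero.mpr (hp j).ne_zero),
    hprod, padicValRat_bitProd_of_forall_ne hp hinj _ Nat.prime_two hp2]
  have h := padicValRat.self (p := 2) one_lt_two
  simp only [Nat.cast_ofNat] at h
  rw [h]; simp

/-- `χ₄(2 ∏ pᵢ) = Σⱼ uⱼ` (`= χ₄(∏ pᵢ)`). [folklore] -/
private theorem chi4_n (hp : ∀ i, (p i).Prime) (hp2 : ∀ i, p i ≠ 2) :
    chi4 ((2 * ∏ i, p i : ℕ) : ℚ) = ∑ j, addLegendreSym (-1) (p j) := by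
  rw [show ((2 * ∏ j, p j : ℕ) : ℚ) = (2 : ℚ) ^ (1 : ℤ) * (((∏ j, (p j : ℤ) : ℤ)) : ℚ) by push_cast; ring,
    chi4_two_zpow_mul, chi4_prod hp hp2]

/-- **Monsky's `2`-Selmer formula for even `n`, LOWER-BOUND HALF, for every number of prime factors**:
for distinct odd primes `p₁, …, p_k` and `n = 2p₁⋯p_k`, `2^{2+s(n)} ≤ #Sel⁽²⁾(E_n/ℚ)`,
`s(n) = 2k − rank_{𝔽₂} M`, `M = ( Aᵀ + D₂  D₋₁ ; D₂  A + D₂ )` (`monskyMatrixEven`). Proof: the normalising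
character `ν = (v₂(b), χ₄(b))` on `Sel⁽²⁾` is surjective onto `(ℤ/2)²` (torsion-pair classes), and
`ker M ↪ ker ν` by `x ↦ c(∏pᵢ^{αᵢ}, candB β)` (a Selmer class with coordinates `x`); `Sel⁽²⁾` is finite.
[cite: HeathBrown1994SelmerCongruentII, Appendix (Monsky), typescript p. 41 L1–L36; §1 p. 1 L14–L20]
[cite: SilvermanAEC2009, Prop. X.1.4, Thm. X.4.2, Prop. X.4.9] -/
theorem card_selmerGroup_two_ge_pow (hp : ∀ i, (p i).Prime) (hp2 : ∀ i, p i ≠ 2) (hinj : Function.Injective p) :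
    2 ^ (2 + monskySelmerRankEven p) ≤ Nat.card ((congruentNumberCurve (2 * ∏ i, p i)).selmerGroup 2) := by
  haveI := isElliptic_congruentNumberCurve (n_ne_zero hp)
  haveI : Fact (Nat.Prime 2) := ⟨Nat.prime_two⟩
  haveI : ∀ i, Fact (p i).Prime := fun i => ⟨hp i⟩
  have hT := splitTwoTorsion_cn (2 * ∏ i, p i)
  set W := congruentNumberCurve (2 * ∏ i, p i) with hW
  haveI : Finite (W.selmerGroup 2) := W.finite_selmerGroup_holds (n := 2) two_ne_zero
  -- the second component, the normalising character `ν` and the coordinates `ψ`, as additive maps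
  obtain ⟨F₁, hF₁⟩ : ∃ F₁ : galH1Torsion W 2 →+ Additive (SqUnits ℚ),
      ∀ c, F₁ c = kummerEquiv ℚ 2 (W.twoTorsionCharH1 hT c) :=
    ⟨(kummerEquiv ℚ 2).toAddMonoidHom.comp (W.twoTorsionCharH1 hT), fun c => rfl⟩
  obtain ⟨F₂, hF₂⟩ : ∃ F₂ : galH1Torsion W 2 →+ Additive (SqUnits ℚ),
      ∀ c, F₂ c = kummerEquiv ℚ 2 (W.twoTorsionCharH1 hT.swap₁₂ c) :=
    ⟨(kummerEquiv ℚ 2).toAddMonoidHom.comp (W.twoTorsionCharH1 hT.swap₁₂), fun c => rfl⟩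
  obtain ⟨ν, hν⟩ : ∃ ν : galH1Torsion W 2 →+ ZMod 2 × ZMod 2,
      ∀ c, ν c = (parityHom 2 (F₂ c), chi4Hom (F₂ c)) :=
    ⟨((parityHom 2).comp F₂).prod (chi4Hom.comp F₂), fun c => rfl⟩
  obtain ⟨ψ, hψ⟩ : ∃ ψ : galH1Torsion W 2 →+ (Fin k ⊕ Fin k → ZMod 2), ∀ c,
      ψ c = Sum.elim (fun i => parityHom (p i) (F₂ c)) (fun i => parityHom (p i) (F₁ c)) :=
    ⟨AddMonoidHom.pi fun s => Sum.elim (fun i => (parityHom (p i)).comp F₂)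
        (fun i => (parityHom (p i)).comp F₁) s,
      fun c => by funext s; rcases s with i | i <;> rfl⟩
  -- their values on the class of a pair `(a, b)`
  have hval : ∀ a b : ℚˣ, ν (W.twoDescentClass hT a b) = (parityBit 2 (b : ℚ), chi4 (b : ℚ)) ∧
      ψ (W.twoDescentClass hT a b) =
        Sum.elim (fun i => parityBit (p i) (b : ℚ)) (fun i => parityBit (p i) (a : ℚ)) := by
    intro a b
    have h1 : F₁ (W.twoDescentClass hT a b) = Additive.ofMul (sqClass (a : ℚ)) := by
      rw [hF₁, W.kummerEquiv_twoTorsionCharH1_twoDescentClass hT a b,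
        CongruentNumberTwicePrimePairSelmer.mk_eq_sqClass]
    have h2 : F₂ (W.twoDescentClass hT a b) = Additive.ofMul (sqClass (b : ℚ)) := by
      rw [hF₂, W.kummerEquiv_twoTorsionCharH1_swap_twoDescentClass hT a b,
        CongruentNumberTwicePrimePairSelmer.mk_eq_sqClass]
    refine ⟨?_, ?_⟩
    · rw [hν, h2, parityHom_sqClass b.ne_zero, chi4Hom_sqClass b.ne_zero]
    · rw [hψ, h1, h2]
      congr 1 <;> funext i <;> exact parityHom_sqClass (Units.ne_zero _)
  set νS : W.selmerGroup 2 →+ ZMod 2 × ZMod 2 := ν.comp (W.selmerGroup 2).subtype with hνS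
  -- (a) `ν` is surjective on `Sel⁽²⁾`: the torsion pairs
  have hn0 : ((2 * ∏ i, p i : ℕ) : ℚ) ≠ 0 := by exact_mod_cast n_ne_zero hp
  set N : ℚ := ((2 * ∏ i, p i : ℕ) : ℚ) with hN
  have v2N : parityBit 2 N = 1 := by unfold parityBit; rw [hN, padicValRat_two_n hp hp2 hinj]; rfl
  have c4N : chi4 N = ∑ j, addLegendreSym (-1) (p j) := chi4_n hp hp2
  have mem_range : ∀ a b : ℚˣ, W.twoDescentClass hT a b ∈ W.selmerGroup 2 →
      (parityBit 2 (b : ℚ), chi4 (b : ℚ)) ∈ νS.range := fun a b hab =>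
    ⟨⟨_, hab⟩, by rw [hνS, AddMonoidHom.comp_apply, AddSubgroup.coe_subtype, (hval a b).1]⟩
  have h11 := one_add_one_zmod2
  have r00 : ((0 : ZMod 2), (0 : ZMod 2)) ∈ νS.range := ⟨0, by rw [_root_.map_zero]; rfl⟩
  have r01 : ((0 : ZMod 2), (1 : ZMod 2)) ∈ νS.range := by
    -- `T₂ = (0, 0)`: pair `(n, −n²)`
    have hb0 : ((0 : ℚ) - -N) * (0 - N) ≠ 0 := by
      rw [show ((0 : ℚ) - -N) * (0 - N) = -(N * N) by ring]; exact neg_ne_zero.mpr (mul_ne_zero hn0 hn0)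
    have hmem := twoDescentClass_mem_selmerGroup_T₂ W hT (Units.mk0 ((0 : ℚ) - -N) (by rw [sub_neg_eq_add, zero_add]; exact hn0))
      (Units.mk0 _ hb0) rfl rfl
    have key := mem_range _ _ hmem
    rw [Units.val_mk0, show ((0 : ℚ) - -N) * (0 - N) = -1 * (N * N) by ring, parityBit_mul (by norm_num) (mul_ne_zero hn0 hn0),
      parityBit_mul hn0 hn0, chi4_mul (by norm_num) (mul_ne_zero hn0 hn0), chi4_mul_self, chi4_neg_one] at key
    have e1 : parityBit 2 (-1 : ℚ) = 0 := by unfold parityBit; rw [padicValRat.neg, padicValRat.one]; rfl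
    rw [e1, v2N, h11] at key
    simpa using key
  have r1x : ((1 : ZMod 2), 1 + ∑ j, addLegendreSym (-1) (p j)) ∈ νS.range ∧
      ((1 : ZMod 2), ∑ j, addLegendreSym (-1) (p j)) ∈ νS.range := by
    constructor
    · -- `T₁ = (−n, 0)`: pair `(2n², −n)`
      have hmem := twoDescentClass_mem_selmerGroup_T₁ W hT (Units.mk0 ((-N - 0) * (-N - N)) (by
          rw [show (-N - 0) * (-N - N) = 2 * (N * N) by ring]; exact mul_ne_zero two_ne_zero (mul_ne_zero hn0 hn0)))
        (Units.mk0 (-N - 0) (by rw [sub_zero]; exact neg_ne_zero.mpr hn0)) rfl rfl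
      have key := mem_range _ _ hmem
      rw [Units.val_mk0, show (-N - 0 : ℚ) = -1 * N by ring, parityBit_mul (by norm_num) hn0,
        chi4_mul (by norm_num) hn0, chi4_neg_one, v2N, c4N] at key
      have e1 : parityBit 2 (-1 : ℚ) = 0 := by unfold parityBit; rw [padicValRat.neg, padicValRat.one]; rfl
      rw [e1, zero_add] at key
      exact key
    · -- `T₃ = (n, 0)`: pair `(2n, n)`
      have hmem := twoDescentClass_mem_selmerGroup_T₃ W hT (Units.mk0 (N - -N) (by
          rw [show N - -N = 2 * N by ring]; exact mul_ne_zero two_ne_zero hn0))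
        (Units.mk0 (N - 0) (by rw [sub_zero]; exact hn0)) rfl rfl
      have key := mem_range _ _ hmem
      rw [Units.val_mk0, sub_zero, v2N, c4N] at key
      exact key
  have hrange : νS.range = ⊤ := by
    rw [eq_top_iff]
    rintro ⟨x, y⟩ -
    rcases zmod2_cases x with hx | hx <;> rcases zmod2_cases y with hy | hy <;> subst hx <;> subst hy
    · exact r00
    · exact r01
    · rcases zmod2_cases (∑ j, addLegendreSym (-1) (p j)) with h | h
      · have := r1x.2; rwa [h] at this
      · have := r1x.1; rw [h, h11] at this; exact this
    · rcases zmod2_cases (∑ j, addLegendreSym (-1) (p j)) with h | h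
      · have := r1x.1; rwa [h, add_zero] at this
      · have := r1x.2; rwa [h] at this
  have hidx : νS.ker.index = 4 := by
    rw [AddSubgroup.index_ker, hrange, AddSubgroup.card_top, Nat.card_prod, Nat.card_zmod]
  -- (b) `ker M ↪ ker ν`
  let Φ : LinearMap.ker (monskyMatrixEven p).mulVecLin → νS.ker := fun x =>
    ⟨⟨W.twoDescentClass hT (Units.mk0 (bitProd p (fun i => x.1 (Sum.inr i)) : ℚ) (cast_bitProd_ne_zero hp _))
        (Units.mk0 ((candB p (fun i => x.1 (Sum.inl i)) : ℤ) : ℚ) (cast_candB_ne_zero hp _)),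
      twoDescentClass_kernel_mem_selmerGroup hp hp2 hinj (by
        have hx := x.2
        rw [LinearMap.mem_ker, Matrix.mulVecLin_apply] at hx
        have hxe : Sum.elim (fun i => x.1 (Sum.inl i)) (fun i => x.1 (Sum.inr i)) = x.1 := by
          funext s; rcases s with i | i <;> rfl
        rw [hxe]; exact hx)⟩, by
      rw [AddMonoidHom.mem_ker, hνS, AddMonoidHom.comp_apply, AddSubgroup.coe_subtype, (hval _ _).1,
        Units.val_mk0, Prod.mk_eq_zero]
      refine ⟨?_, chi4_candB hp hp2 hinj _⟩
      unfold parityBit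
      rw [padicValRat_candB, padicValRat_bitProd_of_forall_ne hp hinj _ Nat.prime_two hp2]; rfl⟩
  have hψcl : ∀ x : LinearMap.ker (monskyMatrixEven p).mulVecLin,
      ψ (((Φ x : νS.ker) : W.selmerGroup 2) : galH1Torsion W 2) = x.1 := by
    intro x
    change ψ (W.twoDescentClass hT _ _) = x.1
    rw [(hval _ _).2]
    funext s
    rcases s with i | i
    · rw [Sum.elim_inl, Units.val_mk0, parityBit_candB hp hinj]
    · rw [Sum.elim_inr, Units.val_mk0, parityBit_bitProd hp hinj]
  have hΦ : Function.Injective Φ := by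
    intro x y hxy
    apply Subtype.ext
    rw [← hψcl x, ← hψcl y, hxy]
  have hker : 2 ^ (2 * k - (monskyMatrixEven p).rank) ≤ Nat.card νS.ker := by
    have := Nat.card_le_card_of_injective Φ hΦ
    rwa [natCard_ker_mulVecLin_eq, Fintype.card_sum, Fintype.card_fin, ← two_mul] at this
  calc 2 ^ (2 + monskySelmerRankEven p) = 2 ^ (2 * k - (monskyMatrixEven p).rank) * 4 := by
        rw [monskySelmerRankEven, pow_add]; ring
    _ ≤ Nat.card νS.ker * νS.ker.index := by rw [hidx]; exact Nat.mul_le_mul_right 4 hker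
    _ = Nat.card (W.selmerGroup 2) := νS.ker.card_mul_index

/-- **MONSKY'S `2`-SELMER FORMULA FOR EVEN `n` — EQUALITY, for every number of prime factors**: for distinct
odd primes `p₁, …, p_k` and `n = 2p₁⋯p_k`, `#Sel⁽²⁾(E_n/ℚ) = 2^{2+s(n)}` with `s(n) = 2k − rank_{𝔽₂} M`,
`M = ( Aᵀ + D₂  D₋₁ ; D₂  A + D₂ )` Monsky's matrix (`≤`: `card_selmerGroup_two_le_pow`; `≥`:
`card_selmerGroup_two_ge_pow`). [cite: HeathBrown1994SelmerCongruentII, Appendix (Monsky), typescript p. 41 L1–L36; §1 p. 1 L14–L20] -/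
theorem card_selmerGroup_two_eq_pow (hp : ∀ i, (p i).Prime) (hp2 : ∀ i, p i ≠ 2) (hinj : Function.Injective p) :
    Nat.card ((congruentNumberCurve (2 * ∏ i, p i)).selmerGroup 2) = 2 ^ (2 + monskySelmerRankEven p) :=
  le_antisymm (card_selmerGroup_two_le_pow hp hp2 hinj) (card_selmerGroup_two_ge_pow hp hp2 hinj)

end CongruentNumberEvenMonskySelmerExact

/-- **MONSKY'S THEOREM, EVEN CASE, DISCHARGED**: the named fact `HeathBrown1994.monsky_card_selmerGroup_two_even`
(appendix to Heath-Brown, Invent. Math. 118 (1994), even `D`, printed as "a sketch proof": for `D = 2p₁⋯p_k` with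
distinct odd primes, `#Sel₂(E_D/ℚ) = 2^{2+s(D)}`, `s(D) = 2k − rank M`, `M = ( Aᵀ + D₂  D₋₁ ; D₂  A + D₂ )`) is a
THEOREM of the tree: a complete `2`-descent on the cohomological Selmer group (Silverman AEC X.1.4/X.4.9) — upper
bound `CongruentNumberEvenMonskySelmerBound.lean`, lower bound (local solubility of the `2^{s}` systems at every
place, the `2`-adic conditions following from `Mx = 0`) `CongruentNumberEvenMonskySelmerExact.lean`.
[cite: HeathBrown1994SelmerCongruentII, Appendix (Monsky), typescript p. 41 L20–L36; §1 p. 1 L14–L20] -/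
theorem HeathBrown1994.monsky_card_selmerGroup_two_even_holds : HeathBrown1994.monsky_card_selmerGroup_two_even :=
  fun _ _ hp hodd hinj =>
    CongruentNumberEvenMonskySelmerExact.card_selmerGroup_two_eq_pow hp
      (fun i h => Nat.not_even_iff_odd.mpr (hodd i) (h ▸ even_two)) hinj

end Literature.NumberTheory.EllipticCurves

end
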